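/-
Copyright (c) 2026 the pub-hodgecm-mathlib formalisation cell (harness21).  Prover seat hodgecm-mathlib-A-p03 (g26); road «R1LL-tree» (architect A-p16 (g27), RULING A-23 (b);
LEAD F0P3a-plan (g10)), brick (R5b-α-VERTEX) FILE V1 «fixed cosets of a CONJUGATE level ↔ stable lattices of the translated orbit», 2026-09-01.
-/
import Literature.NumberTheory.Automorphic.FixedCosetsStableLatticesSep   -- ★ F0P2-p01 L2a (template at `K = GL_n(𝒪)`): `span_range_transpose_eq_iff`, `…_out_eq_unitary`, `image_sep_fixedBy_unitary_eq`
import Literature.NumberTheory.Automorphic.UnitaryGroupSelfDualLocus      -- ★ `formCongr_mul_eq_formCongr_formCongr`, `exists_mem_glInt_coe_eq_formCongr` (Gram bookkeeping)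
import HarnessLib

/-!
# `γ`-fixed cosets of a CONJUGATE level `K_D = U ∩ D·GL_n(𝒪)·D⁻¹` ↔ `γ`-stable lattices of the orbit `U · (D𝒪ⁿ)`, split by a predicate
# (Kottwitz 1986 §3; Laumon 1996 Lemma (5.3.2); Kottwitz 1988 §2 — the count transport at the SECOND vertex type without a similitude)

Topic `NumberTheory/Automorphic`; namespace `Literature.NumberTheory.Automorphic`.  THEOREMS ONLY (no definition, no instance, no notation, no named fact, no `sorry`);
generic bookkeeping over a field `E` with a `ValuativeRel`.  Cell `pub/hodgecm-mathlib`, crux H413 = stmt-HodgeConjecture-24833, road «R1LL-tree» RAMIFIED branch, brick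
**(R5b-α-VERTEX)** (architect A-p16 (g27) A-23 (b); hand A-p03 (g26)), FILE V1 of 3 (census `F0/P3a/A-p03/g26/CENSUS-R5b-alpha-VERTEX.A-p03g26.md`).  HONEST LABEL: HC_CM is proved only
modulo the printed citations until rung 0 closes; nothing printed is asserted here.

WHY.  ★ `FixedCosetsStableLatticesSep` (F0P2-p01) reads the `γ`-fixed cosets of `U ⧸ (U ∩ GL_n(𝒪))` as the `γ`-stable lattices `Λ(u) = u·𝒪ⁿ`, `u ∈ U` — the SELF-DUAL
vertices.  At an INERT place the second vertex type `K¹ = U ∩ D_ϖ GL_n(𝒪) D_ϖ⁻¹` was reached by the similitude `Ad(D_ϖ)` (★ B-p10 (H4)); at a TAMELY RAMIFIED place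
`D_η = diag(1, η)` is NOT a similitude of `Φ₂` (`ᵗσ D_η Φ₂ D_η = η·antidiag(1,−1)`, ★ A-p03 p843555), so the vertex stabiliser `K♯ = U ∩ D_η GL₂(𝒪) D_η⁻¹` needs the
dictionary DIRECTLY: this file is ★ L2a with the base lattice `𝒪ⁿ` replaced by `D·𝒪ⁿ` and `GL_n(𝒪)` by its conjugate `D·GL_n(𝒪)·D⁻¹`, for an ARBITRARY `D ∈ GL_n(E)`:
`q ↦ Λ_D(q.out) := span of the columns of q.out·D` identifies `Fix_γ(U ⧸ K_D)` with the `γ`-stable lattices `Λ_D(u)`, `u ∈ U`, predicate by predicate.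

* §1 `GL_n`: `mem_map_conj_glInt_iff` (`x ∈ D GL_n(𝒪) D⁻¹ ↔ D⁻¹ x D ∈ GL_n(𝒪)`), `span_range_transpose_mul_eq_iff` (`Λ_D(g) = Λ_D(g′) ↔ g⁻¹g′ ∈ D GL_n(𝒪) D⁻¹`),
  `map_span_range_transpose_mul_eq_self_iff` (`γΛ_D(g) = Λ_D(g) ↔ g⁻¹γg ∈ D GL_n(𝒪) D⁻¹`).
* §2 `U(J)` with `K_D := ((glInt n E).map (MulAut.conj D)).subgroupOf U`: `span_range_transpose_out_mul_eq_unitary`, `injOn_span_out_mul_unitary`,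
  `map_span_range_transpose_mul_eq_self_iff_mem_fixedBy_unitary`, `coe_conj_out_mem_glInt_of_mem_fixedBy_conj` (`q ∈ Fix_γ ⇒ D⁻¹(q.out⁻¹ γ q.out)D ∈ GL_n(𝒪)`),
  **`image_sep_fixedBy_conj_unitary_eq`**, **`ncard_sep_fixedBy_conj_unitary_eq_ncard`**, `finite_fixedBy_conj_unitary_of_finite`.
* §3 DOCKING by the Gram matrix: if every `g` with `ᵗσ(g) J g ∈ c · GL_n(𝒪)` factors `g = u·D·k` (`u ∈ U`, `k ∈ GL_n(𝒪)` — (hB), e.g. ★ A-p06 at a tamely ramified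
  place with `c = η`, my ★ `exists_mem_unitaryGroupOfForm_mul_glDiagonal_mul_of_modular_of_ramified`) and `ᵗσ(D) J D ∈ c · GL_n(𝒪)`, then the orbit `{Λ_D(u)}` IS the set of
  `c`-MODULAR lattices: `exists_mem_unitary_span_mul_eq_iff_modular`; hence `ncard_sep_fixedBy_conj_unitary_eq_ncard_modular` (cosets ↔ `γ`-stable `c`-modular lattices).

## References
* [Kottwitz1986] R. E. Kottwitz, *Base change for unit elements of Hecke algebras*, Compositio Math. 60 (1986), §3.
* [Laumon1995] G. Laumon, *Cohomology of Drinfeld Modular Varieties* I (1996), Lemma (5.3.2) p. 136.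
* [Kottwitz1988] R. E. Kottwitz, *Tamagawa numbers*, Ann. of Math. 127 (1988), §2 (the two vertex types of the tree of `U(1,1)`).
* [Jacobowitz1962] R. Jacobowitz, *Hermitian forms over local fields*, Amer. J. Math. 84 (1962), §8 (`𝔓`-modular lattices).
-/

set_option autoImplicit false
noncomputable section
open scoped ValuativeRel Matrix MatrixGroups
open Set
namespace Literature.NumberTheory.Automorphic

/-! ## §1 `GL_n(E) ⊃ D·GL_n(𝒪)·D⁻¹` -/
section GLn
variable {E : Type*} [Field E] [ValuativeRel E] {n : ℕ} (D : GL (Fin n) E)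

/-- `x ∈ D·GL_n(𝒪)·D⁻¹ ↔ D⁻¹ x D ∈ GL_n(𝒪)` (the `(MulAut.conj D)`-image of `glInt`). [cite: Kottwitz1988, §2] -/
theorem mem_map_conj_glInt_iff (x : GL (Fin n) E) :
    x ∈ (glInt n E).map (MulAut.conj D).toMonoidHom ↔ D⁻¹ * x * D ∈ glInt n E := by
  rw [Subgroup.mem_map_equiv, MulAut.conj_symm_apply]

/-- **`Λ_D(g) = Λ_D(g′) ↔ g⁻¹ g′ ∈ D GL_n(𝒪) D⁻¹`** (`Λ_D(g) := 𝒪`-span of the columns of `g D`). [cite: Kottwitz1986, §3] [cite: Laumon1995, Lemma (5.3.2) p. 136] -/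
theorem span_range_transpose_mul_eq_iff (g g' : GL (Fin n) E) :
    Submodule.span 𝒪[E] (Set.range (((g * D : GL (Fin n) E) : Matrix (Fin n) (Fin n) E))ᵀ) =
        Submodule.span 𝒪[E] (Set.range (((g' * D : GL (Fin n) E) : Matrix (Fin n) (Fin n) E))ᵀ) ↔
      g⁻¹ * g' ∈ (glInt n E).map (MulAut.conj D).toMonoidHom := by
  rw [span_range_transpose_eq_iff, mem_map_conj_glInt_iff]
  have h : (g * D)⁻¹ * (g' * D) = D⁻¹ * (g⁻¹ * g') * D := by group
  rw [h]

/-- **`γ · Λ_D(g) = Λ_D(g) ↔ g⁻¹ γ g ∈ D GL_n(𝒪) D⁻¹`.** [cite: Kottwitz1986, §3] [cite: Laumon1995, Lemma (5.3.2) p. 136] -/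
theorem map_span_range_transpose_mul_eq_self_iff (γ g : GL (Fin n) E) :
    (Submodule.span 𝒪[E] (Set.range (((g * D : GL (Fin n) E) : Matrix (Fin n) (Fin n) E))ᵀ)).map
        ((Matrix.toLin' (γ : Matrix (Fin n) (Fin n) E)).restrictScalars 𝒪[E]) =
      Submodule.span 𝒪[E] (Set.range (((g * D : GL (Fin n) E) : Matrix (Fin n) (Fin n) E))ᵀ) ↔
      g⁻¹ * γ * g ∈ (glInt n E).map (MulAut.conj D).toMonoidHom := by
  rw [map_span_range_transpose_eq_self_iff, mem_map_conj_glInt_iff]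
  have h : (g * D)⁻¹ * γ * (g * D) = D⁻¹ * (g⁻¹ * γ * g) * D := by group
  rw [h]

end GLn

/-! ## §2 The unitary group `U(J)` and the conjugate level `K_D = U ∩ D·GL_n(𝒪)·D⁻¹` -/
section Unitary
variable {E : Type*} [Field E] [ValuativeRel E] {n : ℕ} (σ : E →+* E) (J : GL (Fin n) E) (D : GL (Fin n) E)

/-- `Λ_D(out (u K_D)) = Λ_D(u)` in `U = U(J)`. [cite: Kottwitz1986, §3] -/
theorem span_range_transpose_out_mul_eq_unitary (u : ↥(unitaryGroupOfForm σ (J : Matrix (Fin n) (Fin n) E))) :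
    Submodule.span 𝒪[E] (Set.range (((((((u : ↥(unitaryGroupOfForm σ (J : Matrix (Fin n) (Fin n) E))) :
        ↥(unitaryGroupOfForm σ (J : Matrix (Fin n) (Fin n) E)) ⧸ ((glInt n E).map (MulAut.conj D).toMonoidHom).subgroupOf (unitaryGroupOfForm σ (J : Matrix (Fin n) (Fin n) E))).out :
          ↥(unitaryGroupOfForm σ (J : Matrix (Fin n) (Fin n) E))) : GL (Fin n) E) * D : GL (Fin n) E) : Matrix (Fin n) (Fin n) E))ᵀ) =
      Submodule.span 𝒪[E] (Set.range ((((u : GL (Fin n) E) * D : GL (Fin n) E) : Matrix (Fin n) (Fin n) E))ᵀ) := by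
  obtain ⟨k, hk⟩ := QuotientGroup.mk_out_eq_mul (((glInt n E).map (MulAut.conj D).toMonoidHom).subgroupOf (unitaryGroupOfForm σ (J : Matrix (Fin n) (Fin n) E))) u
  rw [hk, Subgroup.coe_mul, eq_comm, span_range_transpose_mul_eq_iff, inv_mul_cancel_left]
  exact (Subgroup.mem_subgroupOf).1 k.2

/-- `q ↦ Λ_D(q.out)` is injective on `U ⧸ K_D`. [cite: Kottwitz1986, §3] -/
theorem injOn_span_out_mul_unitary
    (S : Set (↥(unitaryGroupOfForm σ (J : Matrix (Fin n) (Fin n) E)) ⧸ ((glInt n E).map (MulAut.conj D).toMonoidHom).subgroupOf (unitaryGroupOfForm σ (J : Matrix (Fin n) (Fin n) E)))) :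
    Set.InjOn (fun q : ↥(unitaryGroupOfForm σ (J : Matrix (Fin n) (Fin n) E)) ⧸
        ((glInt n E).map (MulAut.conj D).toMonoidHom).subgroupOf (unitaryGroupOfForm σ (J : Matrix (Fin n) (Fin n) E)) =>
      Submodule.span 𝒪[E] (Set.range (((((q.out : ↥(unitaryGroupOfForm σ (J : Matrix (Fin n) (Fin n) E))) : GL (Fin n) E) * D : GL (Fin n) E) :
        Matrix (Fin n) (Fin n) E))ᵀ)) S := by
  intro q _ q' _ h
  have h' := (span_range_transpose_mul_eq_iff D
    ((q.out : ↥(unitaryGroupOfForm σ (J : Matrix (Fin n) (Fin n) E))) : GL (Fin n) E)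
    ((q'.out : ↥(unitaryGroupOfForm σ (J : Matrix (Fin n) (Fin n) E))) : GL (Fin n) E)).1 h
  rw [← Quotient.out_eq q, ← Quotient.out_eq q']
  refine QuotientGroup.eq.2 ((Subgroup.mem_subgroupOf).2 ?_)
  rw [Subgroup.coe_mul, Subgroup.coe_inv]
  exact h'

/-- **THE DICTIONARY at `K_D`: `γ · Λ_D(u) = Λ_D(u) ↔ γ · u K_D = u K_D`.** [cite: Kottwitz1986, §3] [cite: Laumon1995, Lemma (5.3.2) p. 136] -/
theorem map_span_range_transpose_mul_eq_self_iff_mem_fixedBy_unitary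
    (γ u : ↥(unitaryGroupOfForm σ (J : Matrix (Fin n) (Fin n) E))) :
    (Submodule.span 𝒪[E] (Set.range ((((u : GL (Fin n) E) * D : GL (Fin n) E) : Matrix (Fin n) (Fin n) E))ᵀ)).map
        ((Matrix.toLin' (((γ : GL (Fin n) E) : Matrix (Fin n) (Fin n) E))).restrictScalars 𝒪[E]) =
      Submodule.span 𝒪[E] (Set.range ((((u : GL (Fin n) E) * D : GL (Fin n) E) : Matrix (Fin n) (Fin n) E))ᵀ) ↔
      ((u : ↥(unitaryGroupOfForm σ (J : Matrix (Fin n) (Fin n) E))) :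
          ↥(unitaryGroupOfForm σ (J : Matrix (Fin n) (Fin n) E)) ⧸ ((glInt n E).map (MulAut.conj D).toMonoidHom).subgroupOf (unitaryGroupOfForm σ (J : Matrix (Fin n) (Fin n) E))) ∈
        MulAction.fixedBy
          (↥(unitaryGroupOfForm σ (J : Matrix (Fin n) (Fin n) E)) ⧸ ((glInt n E).map (MulAut.conj D).toMonoidHom).subgroupOf (unitaryGroupOfForm σ (J : Matrix (Fin n) (Fin n) E))) γ := by
  rw [map_span_range_transpose_mul_eq_self_iff, mem_fixedBy_quotient_mk_iff, Subgroup.mem_subgroupOf, Subgroup.coe_mul,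
    Subgroup.coe_mul, Subgroup.coe_inv]

/-- **A fixed coset of `K_D` reads `γ` integrally after conjugating by `D`**: `q ∈ Fix_γ(U ⧸ K_D) ⇒ D⁻¹ (q.out⁻¹ γ q.out) D ∈ GL_n(𝒪)`. [cite: Kottwitz1988, §2] -/
theorem coe_conj_out_mem_glInt_of_mem_fixedBy_conj (γ : ↥(unitaryGroupOfForm σ (J : Matrix (Fin n) (Fin n) E)))
    (q : ↥(unitaryGroupOfForm σ (J : Matrix (Fin n) (Fin n) E)) ⧸ ((glInt n E).map (MulAut.conj D).toMonoidHom).subgroupOf (unitaryGroupOfForm σ (J : Matrix (Fin n) (Fin n) E)))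
    (hq : q ∈ MulAction.fixedBy (↥(unitaryGroupOfForm σ (J : Matrix (Fin n) (Fin n) E)) ⧸
        ((glInt n E).map (MulAut.conj D).toMonoidHom).subgroupOf (unitaryGroupOfForm σ (J : Matrix (Fin n) (Fin n) E))) γ) :
    D⁻¹ * (((q.out⁻¹ * γ * q.out : ↥(unitaryGroupOfForm σ (J : Matrix (Fin n) (Fin n) E)))) : GL (Fin n) E) * D ∈ glInt n E := by
  have h : (q.out : ↥(unitaryGroupOfForm σ (J : Matrix (Fin n) (Fin n) E)) ⧸ ((glInt n E).map (MulAut.conj D).toMonoidHom).subgroupOf (unitaryGroupOfForm σ (J : Matrix (Fin n) (Fin n) E))) ∈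
      MulAction.fixedBy (↥(unitaryGroupOfForm σ (J : Matrix (Fin n) (Fin n) E)) ⧸
        ((glInt n E).map (MulAut.conj D).toMonoidHom).subgroupOf (unitaryGroupOfForm σ (J : Matrix (Fin n) (Fin n) E))) γ := by
    rw [QuotientGroup.out_eq']; exact hq
  rw [mem_fixedBy_quotient_mk_iff, Subgroup.mem_subgroupOf, mem_map_conj_glInt_iff] at h
  rw [Subgroup.coe_mul, Subgroup.coe_mul, Subgroup.coe_inv]
  exact h

/-- **`u K_D ↦ Λ_D(u)` maps `{q ∈ Fix_γ(U ⧸ K_D) | P(Λ_D(q.out))}` ONTO the `γ`-stable lattices `Λ_D(u)`, `u ∈ U`, satisfying `P`.**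
[cite: Kottwitz1986, §3] [cite: Laumon1995, Lemma (5.3.2) p. 136] [cite: Kottwitz1988, §2] -/
theorem image_sep_fixedBy_conj_unitary_eq (γ : ↥(unitaryGroupOfForm σ (J : Matrix (Fin n) (Fin n) E)))
    (P : Submodule 𝒪[E] (Fin n → E) → Prop) :
    (fun q : ↥(unitaryGroupOfForm σ (J : Matrix (Fin n) (Fin n) E)) ⧸
        ((glInt n E).map (MulAut.conj D).toMonoidHom).subgroupOf (unitaryGroupOfForm σ (J : Matrix (Fin n) (Fin n) E)) =>
      Submodule.span 𝒪[E] (Set.range (((((q.out : ↥(unitaryGroupOfForm σ (J : Matrix (Fin n) (Fin n) E))) : GL (Fin n) E) * D : GL (Fin n) E) :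
        Matrix (Fin n) (Fin n) E))ᵀ)) ''
        {q ∈ MulAction.fixedBy (↥(unitaryGroupOfForm σ (J : Matrix (Fin n) (Fin n) E)) ⧸
            ((glInt n E).map (MulAut.conj D).toMonoidHom).subgroupOf (unitaryGroupOfForm σ (J : Matrix (Fin n) (Fin n) E))) γ |
          P (Submodule.span 𝒪[E] (Set.range (((((q.out : ↥(unitaryGroupOfForm σ (J : Matrix (Fin n) (Fin n) E))) : GL (Fin n) E) * D : GL (Fin n) E) :
            Matrix (Fin n) (Fin n) E))ᵀ))} =
      {Λ : Submodule 𝒪[E] (Fin n → E) |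
        (∃ u ∈ unitaryGroupOfForm σ (J : Matrix (Fin n) (Fin n) E), Λ = Submodule.span 𝒪[E] (Set.range (((u * D : GL (Fin n) E) : Matrix (Fin n) (Fin n) E))ᵀ)) ∧
          Λ.map ((Matrix.toLin' (((γ : GL (Fin n) E) : Matrix (Fin n) (Fin n) E))).restrictScalars 𝒪[E]) = Λ ∧ P Λ} := by
  ext Λ
  simp only [mem_image, mem_setOf_eq]
  constructor
  · rintro ⟨q, ⟨hq, hP⟩, rfl⟩
    induction q using QuotientGroup.induction_on with
    | H u =>
      rw [span_range_transpose_out_mul_eq_unitary σ J D u] at hP ⊢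
      exact ⟨⟨u, u.2, rfl⟩, (map_span_range_transpose_mul_eq_self_iff_mem_fixedBy_unitary σ J D γ u).2 hq, hP⟩
  · rintro ⟨⟨u, hu, rfl⟩, hΛ, hP⟩
    refine ⟨((⟨u, hu⟩ : ↥(unitaryGroupOfForm σ (J : Matrix (Fin n) (Fin n) E))) :
        ↥(unitaryGroupOfForm σ (J : Matrix (Fin n) (Fin n) E)) ⧸ ((glInt n E).map (MulAut.conj D).toMonoidHom).subgroupOf (unitaryGroupOfForm σ (J : Matrix (Fin n) (Fin n) E))),
      ⟨(map_span_range_transpose_mul_eq_self_iff_mem_fixedBy_unitary σ J D γ ⟨u, hu⟩).1 hΛ, ?_⟩, span_range_transpose_out_mul_eq_unitary σ J D ⟨u, hu⟩⟩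
    rw [span_range_transpose_out_mul_eq_unitary σ J D ⟨u, hu⟩]
    exact hP

/-- **`#{q ∈ Fix_γ(U ⧸ K_D) | P(Λ_D(q.out))} = #{Λ_D(u), u ∈ U | γ Λ = Λ ∧ P Λ}`** (`Set.ncard`) for `U = U(J) ≤ GL_n(E)`, `K_D = U ∩ D·GL_n(𝒪)·D⁻¹` — the count transport
at the vertex type `D·𝒪ⁿ` WITHOUT a similitude (twin of ★ `ncard_sep_fixedBy_unitary_eq_ncard` at `D = 1`). [cite: Kottwitz1988, §2] [cite: Kottwitz1986, §3] -/
theorem ncard_sep_fixedBy_conj_unitary_eq_ncard (γ : ↥(unitaryGroupOfForm σ (J : Matrix (Fin n) (Fin n) E)))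
    (P : Submodule 𝒪[E] (Fin n → E) → Prop) :
    {q ∈ MulAction.fixedBy (↥(unitaryGroupOfForm σ (J : Matrix (Fin n) (Fin n) E)) ⧸
          ((glInt n E).map (MulAut.conj D).toMonoidHom).subgroupOf (unitaryGroupOfForm σ (J : Matrix (Fin n) (Fin n) E))) γ |
        P (Submodule.span 𝒪[E] (Set.range (((((q.out : ↥(unitaryGroupOfForm σ (J : Matrix (Fin n) (Fin n) E))) : GL (Fin n) E) * D : GL (Fin n) E) :
          Matrix (Fin n) (Fin n) E))ᵀ))}.ncard =
      {Λ : Submodule 𝒪[E] (Fin n → E) |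
        (∃ u ∈ unitaryGroupOfForm σ (J : Matrix (Fin n) (Fin n) E), Λ = Submodule.span 𝒪[E] (Set.range (((u * D : GL (Fin n) E) : Matrix (Fin n) (Fin n) E))ᵀ)) ∧
          Λ.map ((Matrix.toLin' (((γ : GL (Fin n) E) : Matrix (Fin n) (Fin n) E))).restrictScalars 𝒪[E]) = Λ ∧ P Λ}.ncard := by
  rw [← image_sep_fixedBy_conj_unitary_eq σ J D γ P, (injOn_span_out_mul_unitary σ J D _).ncard_image]

/-- **`Fix_γ(U ⧸ K_D)` IS FINITE when the `γ`-stable lattices of the orbit `U·(D𝒪ⁿ)` are** (injectivity of `q ↦ Λ_D(q.out)`). [cite: Kottwitz1988, §2] -/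
theorem finite_fixedBy_conj_unitary_of_finite (γ : ↥(unitaryGroupOfForm σ (J : Matrix (Fin n) (Fin n) E)))
    (hfin : {Λ : Submodule 𝒪[E] (Fin n → E) |
        (∃ u ∈ unitaryGroupOfForm σ (J : Matrix (Fin n) (Fin n) E), Λ = Submodule.span 𝒪[E] (Set.range (((u * D : GL (Fin n) E) : Matrix (Fin n) (Fin n) E))ᵀ)) ∧
          Λ.map ((Matrix.toLin' (((γ : GL (Fin n) E) : Matrix (Fin n) (Fin n) E))).restrictScalars 𝒪[E]) = Λ ∧ True}.Finite) :
    (MulAction.fixedBy (↥(unitaryGroupOfForm σ (J : Matrix (Fin n) (Fin n) E)) ⧸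
        ((glInt n E).map (MulAut.conj D).toMonoidHom).subgroupOf (unitaryGroupOfForm σ (J : Matrix (Fin n) (Fin n) E))) γ).Finite := by
  have hsep : {q ∈ MulAction.fixedBy (↥(unitaryGroupOfForm σ (J : Matrix (Fin n) (Fin n) E)) ⧸
          ((glInt n E).map (MulAut.conj D).toMonoidHom).subgroupOf (unitaryGroupOfForm σ (J : Matrix (Fin n) (Fin n) E))) γ | True} =
      MulAction.fixedBy (↥(unitaryGroupOfForm σ (J : Matrix (Fin n) (Fin n) E)) ⧸
          ((glInt n E).map (MulAut.conj D).toMonoidHom).subgroupOf (unitaryGroupOfForm σ (J : Matrix (Fin n) (Fin n) E))) γ := by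
    ext q; simp only [Set.mem_setOf_eq, and_true]
  have himg := image_sep_fixedBy_conj_unitary_eq σ J D γ (fun _ => True)
  rw [hsep] at himg
  rw [← himg] at hfin
  exact Set.Finite.of_finite_image hfin (by rw [← hsep]; exact injOn_span_out_mul_unitary σ J D _)

end Unitary

/-! ## §3 Docking by the Gram matrix: the orbit `U·(D𝒪ⁿ)` is the set of `c`-modular lattices -/
section Docking
variable {E : Type*} [Field E] [ValuativeRel E] {n : ℕ} (σ : E →+* E) (J : GL (Fin n) E) (D : GL (Fin n) E) {c : E}

/-- **THE ORBIT `{Λ_D(u) : u ∈ U}` IS THE SET OF `c`-MODULAR LATTICES** when `ᵗσ(D) J D ∈ c · GL_n(𝒪)` and every `c`-modular frame factors `g = u·D·k` ((hB): `u ∈ U`,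
`k ∈ GL_n(𝒪)` — ★ A-p06 `forall_isModularLattice_exists_latt_mul_eq_of_ramified` ∕ ★ A-p03 `exists_mem_unitaryGroupOfForm_mul_glDiagonal_mul_of_modular_of_ramified` at a tamely
ramified place with `c = η`, `D = diag(1, η)`; ★ F0P2-p02 `exists_mem_unitaryGroupOfForm_mul_mul_of_modular_of_nonsplit` at an inert one).
[cite: Jacobowitz1962, §8] [cite: Kottwitz1988, §2] -/
theorem exists_mem_unitary_span_mul_eq_iff_modular
    (hD : ∃ J' ∈ glInt n E, c • (J' : Matrix (Fin n) (Fin n) E) = formCongr σ D (J : Matrix (Fin n) (Fin n) E))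
    (hB : ∀ g : GL (Fin n) E, (∃ J' ∈ glInt n E, c • (J' : Matrix (Fin n) (Fin n) E) = formCongr σ g (J : Matrix (Fin n) (Fin n) E)) →
      ∃ u ∈ unitaryGroupOfForm σ (J : Matrix (Fin n) (Fin n) E), ∃ k ∈ glInt n E, g = u * D * k)
    (Λ : Submodule 𝒪[E] (Fin n → E)) :
    (∃ u ∈ unitaryGroupOfForm σ (J : Matrix (Fin n) (Fin n) E), Λ = Submodule.span 𝒪[E] (Set.range (((u * D : GL (Fin n) E) : Matrix (Fin n) (Fin n) E))ᵀ)) ↔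
      ∃ g : GL (Fin n) E, (∃ J' ∈ glInt n E, c • (J' : Matrix (Fin n) (Fin n) E) = formCongr σ g (J : Matrix (Fin n) (Fin n) E)) ∧
        Λ = Submodule.span 𝒪[E] (Set.range ((g : Matrix (Fin n) (Fin n) E))ᵀ) := by
  constructor
  · rintro ⟨u, hu, rfl⟩
    refine ⟨u * D, ?_, rfl⟩
    obtain ⟨J', hJ', hJ'e⟩ := hD
    refine ⟨J', hJ', ?_⟩
    have hu' : formCongr σ u (J : Matrix (Fin n) (Fin n) E) = (J : Matrix (Fin n) (Fin n) E) := mem_unitaryGroupOfForm_iff.1 hu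
    rw [UnitaryGroup.formCongr_mul_eq_formCongr_formCongr, hu', hJ'e]
  · rintro ⟨g, hg, rfl⟩
    obtain ⟨u, hu, k, hk, rfl⟩ := hB g hg
    refine ⟨u, hu, ?_⟩
    rw [eq_comm, span_range_transpose_eq_iff, inv_mul_cancel_left]
    exact hk

/-- **COSET COUNTS AT `K_D` ARE `c`-MODULAR LATTICE COUNTS, under any predicate**: with (hB) and `ᵗσ(D) J D ∈ c·GL_n(𝒪)`,
`#{q ∈ Fix_γ(U ⧸ K_D) | P(Λ_D(q.out))} = #{Λ | Λ c-modular ∧ γΛ = Λ ∧ P Λ}` (the VERTEX-type twin of ★ `ncard_sep_fixedBy_eq_ncard_selfDualStable_sep_at`).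
[cite: Kottwitz1988, §2] [cite: Jacobowitz1962, §8] [cite: Rogawski1990, §4.9 Lemma 4.9.3 p. 56] -/
theorem ncard_sep_fixedBy_conj_unitary_eq_ncard_modular (γ : ↥(unitaryGroupOfForm σ (J : Matrix (Fin n) (Fin n) E)))
    (hD : ∃ J' ∈ glInt n E, c • (J' : Matrix (Fin n) (Fin n) E) = formCongr σ D (J : Matrix (Fin n) (Fin n) E))
    (hB : ∀ g : GL (Fin n) E, (∃ J' ∈ glInt n E, c • (J' : Matrix (Fin n) (Fin n) E) = formCongr σ g (J : Matrix (Fin n) (Fin n) E)) →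
      ∃ u ∈ unitaryGroupOfForm σ (J : Matrix (Fin n) (Fin n) E), ∃ k ∈ glInt n E, g = u * D * k)
    (X : Submodule 𝒪[E] (Fin n → E) → Prop)
    (Y : (↥(unitaryGroupOfForm σ (J : Matrix (Fin n) (Fin n) E)) ⧸
        ((glInt n E).map (MulAut.conj D).toMonoidHom).subgroupOf (unitaryGroupOfForm σ (J : Matrix (Fin n) (Fin n) E))) → Prop)
    (hXY : ∀ q ∈ MulAction.fixedBy (↥(unitaryGroupOfForm σ (J : Matrix (Fin n) (Fin n) E)) ⧸
        ((glInt n E).map (MulAut.conj D).toMonoidHom).subgroupOf (unitaryGroupOfForm σ (J : Matrix (Fin n) (Fin n) E))) γ,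
      Y q ↔ X (Submodule.span 𝒪[E] (Set.range (((((q.out : ↥(unitaryGroupOfForm σ (J : Matrix (Fin n) (Fin n) E))) : GL (Fin n) E) * D : GL (Fin n) E) :
        Matrix (Fin n) (Fin n) E))ᵀ))) :
    {q ∈ MulAction.fixedBy (↥(unitaryGroupOfForm σ (J : Matrix (Fin n) (Fin n) E)) ⧸
          ((glInt n E).map (MulAut.conj D).toMonoidHom).subgroupOf (unitaryGroupOfForm σ (J : Matrix (Fin n) (Fin n) E))) γ | Y q}.ncard =
      {Λ : Submodule 𝒪[E] (Fin n → E) |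
          ((∃ g : GL (Fin n) E, (∃ J' ∈ glInt n E, c • (J' : Matrix (Fin n) (Fin n) E) = formCongr σ g (J : Matrix (Fin n) (Fin n) E)) ∧
            Λ = Submodule.span 𝒪[E] (Set.range ((g : Matrix (Fin n) (Fin n) E))ᵀ)) ∧
          Λ.map ((Matrix.toLin' (((γ : GL (Fin n) E) : Matrix (Fin n) (Fin n) E))).restrictScalars 𝒪[E]) = Λ) ∧
          X Λ}.ncard := by
  have hsep : {q ∈ MulAction.fixedBy (↥(unitaryGroupOfForm σ (J : Matrix (Fin n) (Fin n) E)) ⧸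
          ((glInt n E).map (MulAut.conj D).toMonoidHom).subgroupOf (unitaryGroupOfForm σ (J : Matrix (Fin n) (Fin n) E))) γ | Y q} =
      {q ∈ MulAction.fixedBy (↥(unitaryGroupOfForm σ (J : Matrix (Fin n) (Fin n) E)) ⧸
          ((glInt n E).map (MulAut.conj D).toMonoidHom).subgroupOf (unitaryGroupOfForm σ (J : Matrix (Fin n) (Fin n) E))) γ |
        X (Submodule.span 𝒪[E] (Set.range (((((q.out : ↥(unitaryGroupOfForm σ (J : Matrix (Fin n) (Fin n) E))) : GL (Fin n) E) * D : GL (Fin n) E) :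
          Matrix (Fin n) (Fin n) E))ᵀ))} := by
    ext q
    simp only [Set.mem_setOf_eq]
    exact ⟨fun h => ⟨h.1, (hXY q h.1).1 h.2⟩, fun h => ⟨h.1, (hXY q h.1).2 h.2⟩⟩
  rw [hsep, ncard_sep_fixedBy_conj_unitary_eq_ncard σ J D γ X]
  congr 1
  ext Λ
  simp only [Set.mem_setOf_eq]
  rw [exists_mem_unitary_span_mul_eq_iff_modular σ J D hD hB Λ]
  exact and_assoc.symm

end Docking

end Literature.NumberTheory.Automorphic

end
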